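import Summits.BirchSwinnertonDyer.Rank1Residual.Additive.QuadraticBranchKatoBridge
import Summits.BirchSwinnertonDyer.Rank1Residual.Additive.KMCPerrinRiouDescentRankOne
import Summits.BirchSwinnertonDyer.Rank1Residual.Additive.QuadraticBranchDerivativeDictionary
import HarnessLib

/-!
# T-e2-K bridge, §5 — RANK ONE over kmc's SPLIT readings: (C1_η)(V) + bridge + PR^×(W) ⇒ BSD_p, and,
# with the dictionary D_η: (C1_η)(V) + (C2_η-GZ)(W, p) + witness ⇒ BSD_p (cell `bsd-potss`, seat `kmc`
# generation 3; text prepared by cc-typer-5 GEN 49 as the "§5 append" of `QuadraticBranchKatoBridge.lean`,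
# filed as a SIBLING so that the bridge file stays byte-identical and under the size limit)

HONEST FRAMING (cell `bsd-potss`, `run/shared/lean/pub/bsd-potss/`, FULL-BSD rank-`≤ 1` programme
tranche 1b, rows B4/B8 = Gss2 / O7-ss at `e = 2`; typed against the class shells of cell `b2b-bsdres`,
lane CLASS-CLOSURE): NOTHING about Kato's or Kobayashi's main conjectures, about Perrin-Riou's
conjecture or about the `η`-branch `p`-adic Gross–Zagier valuation is asserted, and no Literature fact
is minted. Every input below is a DISPLAYED hypothesis: the bridge `QuadraticBranchKatoBridge KMC`
(T-e2-K, p402082), the dictionary `EtaBranchDerivativeDictionary PRRatio` (T-e2-D, p402639), kmc's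
split rank-one readings `RankOneCountReading IsOf PRRatio` (PRINTED: Burns–Kurihara–Sano Thm. 7.3 /
7.8 (d) in Kato's normalisation), `HasPRRatio PRRatio`, `Realizable IsOf`, the interface lemma
`ReadsTrivialKMC IsOf KMC` (p400784 / p401801), the NAMED conjecture node
`PerrinRiouUpToUnitAt PRRatio W p` (PR^×, p401801), x1b's typed nodes (C1_η)
`QuadraticBranchPlusMainConjectureAt` and (C2_η-GZ) `QuadraticBranchPAdicGrossZagierValuationAt`, and
the published facts GZK (`rank_eq_analyticRank_of_analyticRank_le_one`), modularity
(`hasEntireLFunction_rat`), Gross–Zagier I.(7.3) (`GrossZagier1986_thm_I_7_3`). Census numbers are not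
inputs of anything; nothing is booked; no mark of `RESIDUAL-MAP.md` moves; Gss2 stays OPEN.

## What is proved (kernel assemblies; TARGET v4 §6 item 14 / v6 R61 "§5 bridge append")

§4 of `QuadraticBranchKatoBridge.lean` went through kmc's conjecture-CONTAINING schema
`RankOnePRCountReading` (p400947). Since kmc part 5 (p401801) the conjectural input is a NAMED node,
`PerrinRiouUpToUnitAt PRRatio W p` (PR^× = Perrin-Riou's 'Kato point' formula up to a `p`-adic unit,
Burns–Kurihara–Sano Conj. 1.5 at `r = 1`), and the count is the PRINTED Reading 1″
`RankOneCountReading IsOf PRRatio`; kmc part 6 (p401912) proved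
`rankOne_missingPPartAt_of_kmc_of_perrinRiou` : KMC⁰ → PR^× → BSD_p over them. Here:
* `missingPPartAt_rankOne_of_plusMC_of_perrinRiou_of_bridge` / `bsdp_…`: **(C1_η)(V) + PR^×(W) ⇒
  `MissingPPartAt W p` / `BSDp W p`** in analytic rank one at the additive twist `W = V ⊗ η` under
  (12.5.2) — `kmc_of_plusMC_of_bridge` feeds part 6. No `p`-adic height, no control theorem, no
  (C2_η-GZ), no (C3_η).
* `missingPPartAt_rankOne_of_plusMC_of_pAdicGrossZagier_of_bridge_of_dictionary` / `bsdp_…`: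
  **(C1_η)(V) + (C2_η-GZ)(W, p) + a witness of (C2_η-GZ)'s binders ⇒ `MissingPPartAt W p` /
  `BSDp W p`** — (C2_η-GZ) + D_η ⇒ PR^×(W) by cc-typer-5's
  `perrinRiouUpToUnit_of_pAdicGrossZagierValuation_of_dictionary` (the rational value of
  `L′(W,1)/(Ω_W·Reg W)` it displays comes from Gross–Zagier I.(7.3) + GZK), then the previous theorem.
  This is the KATO chain driven by x1b's two typed nodes; the SIGNED chain
  (`bsdp_of_quadraticBranchPAdicGrossZagierValuation_of_exactControl`, p307042) uses (C1_η), (C2_η-GZ)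
  and (C3_η). TARGET v4 §6 item 14: "the two Gss2 chains are ONE theorem modulo
  {C1_η ≡ KMC⁰(W) (bridge), PR^× ≡ C2_η-GZ (dictionary), readings}" — kernel form.

## The planner's Pal-2012 fold of the bridge's step (B2b) (TARGET v4 §6.14 (3) / v3 R31; record only)

The bridge's docstring isolates as its one new step (B2b) `Z(f_W, T_pW)^Δ = Z(f_V, T_pV)^η`,
"equivalent to a `p`-adic-unit period relation of the shape `Ω_W^± ~ Ω_V^∓/√p*`". The NÉRON-PERIOD
part of that relation IS IN PRINT: V. Pal, *Periods of quadratic twists of elliptic curves*, Proc.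
AMS 140 (2012) = arXiv:1012.0094, Prop. 2.5 / **Cor. 2.6** ("Suppose `d` is coprime to `Δ`. Then `ũ`
is a power of `2`. Moreover if `d ≡ 1 mod 4`, then `ũ = 1`" — here `d = p* = (−1)^{(p−1)/2} p ≡ 1
(mod 4)` and `(d, Δ_V) = 1` because `V` is good at `p`), Lemma 3.1 (`ω(E^d_min) = ũ·ω(E)/√d`) and
**Thm. 3.2** (`Ω(E^d) = (ũ/√d)·Ω(E)`, resp. `(ũ/√d)·c_∞(E^d)·Ω⁻(E)`) [corpus: paper:arxiv-1012.0094
p0005 L17–21, p0006 L5–26, re-read by this seat]; numerically the rank-`0` binder `hΩ` reads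
`v_p(ρ) = 0` on 739/739 Gss2 `r = 0` rows (referee g4, W12 table sha16 0003920362bf91ba — EVIDENCE,
not an input); and x1b's p403311 discharges the period-ratio binder at `p ≡ 1 (mod 4)` from the named
fact `hGV` (TARGET v6 R63). What is LEFT of (B2b) is therefore not a period relation but: Kobayashi's
Gauss-sum convention for `ε_η` ((6.10)–(6.11)), Kato's `exp*`-characterisation of `z_γ` (Thm. 12.5
(1)), the injectivity of `(Col⁺, Col⁻) ∘ ε_η` on the `η`-part (TARGET v3 §0.5 claim (a), referee g4
NOTE 2: the binder "`H¹_Iw(k_∞,T)^η` torsion-free of `Λ^η`-rank `2`") and the Shapiro `η`-projectors —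
owner `-ctrl`. Pal's relation is NOT used and NOT assumed anywhere in this file or in the bridge file.

WHAT THIS IS NOT. Not a proof of the bridge, of the dictionary, of (C1_η), of (C2_η-GZ), of PR^× or
of `KMC` for any curve; nothing at `p = 2`; nothing off (12.5.2) (kmc g3's torsion-free descent,
`KatoDescentTorsionFree.lean`, is the (12.5.2)-free road and does not pass through the bridge); no
class is closed and no census number is an input. Net debt `0`: theorems only; no `sorry`, axioms
standard.

References: S. Kobayashi, Invent. Math. 152 (2003) (3.7) (p. 7), Thm. 6.3 (p. 11), Thm. 7.4 (p. 13)
[Kobayashi2003]; K. Kato, Astérisque 295 (2004) Thm. 12.5 and (12.5.2) (p. 222), Conj. 12.10 (p. 224),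
§14.14 (p. 243) [Kato2004Asterisque]; D. Burns, M. Kurihara, T. Sano, JMSJ 76 (2024) =
arXiv:1910.07404, Conj. 1.5 (p. 6), Thm. 7.3, Thm. 7.6 and Remark 7.7 (p. 29), Thm. 7.8 (d) (p. 30)
[BurnsKuriharaSano2019]; B. Gross, D. Zagier, Invent. Math. 84 (1986) Thm. I.(7.3) [GrossZagier1986];
V. Pal, Proc. AMS 140 (2012) 1513–1525 = arXiv:1012.0094, Cor. 2.6, Lemma 3.1, Thm. 3.2 [Pal2012];
R. L. Miller, LMS JCM 14 (2011) Def. 1.1 [Miller2011LMS].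
-/

set_option autoImplicit false

noncomputable section

open scoped Classical MatrixGroups ModularForm

open CongruenceSubgroup WeierstrassCurve Literature.NumberTheory.EllipticCurves
  Literature.NumberTheory.EllipticCurves.ModularForms
  Literature.NumberTheory.EllipticCurves.Rank1Residual
  Literature.NumberTheory.EllipticCurves.Rank1Residual.Typed
  Literature.NumberTheory.EllipticCurves.IwasawaAlgebra

namespace Summit.BirchSwinnertonDyer.Rank1Residual.Additive

section BridgeRankOneSplit

variable {IsOf : ∀ (W : WeierstrassCurve ℚ) [W.IsElliptic] [W.IsGloballyMinimal] (p : ℕ) [Fact p.Prime],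
  KatoDescentDatum p → Prop}
variable {PRRatio : ∀ (W : WeierstrassCurve ℚ) [W.IsElliptic] [W.IsGloballyMinimal] (p : ℕ)
  [Fact p.Prime], ℚ_[p] → Prop}
variable {KMC : ∀ (W : WeierstrassCurve ℚ) [W.IsElliptic] [W.IsGloballyMinimal] (p : ℕ), Prop}

/-- **RANK ONE — (C1_η)(V) + PR^×(W) ⇒ `MissingPPartAt W p`** over kmc's PRINTED rank-one count
(Reading 1″ `RankOneCountReading IsOf PRRatio`, no conjecture inside), Reading 3 (`Realizable`), the
interface lemma and the bridge: `kmc_of_plusMC_of_bridge` feeds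
`rankOne_missingPPartAt_of_kmc_of_perrinRiou` (kmc part 6, p401912). Inputs named: the even main
conjecture (C1_η) of the good twin `V` and Perrin-Riou's 'Kato point' formula UP TO A UNIT for `W`
(`PerrinRiouUpToUnitAt`, Burns–Kurihara–Sano Conj. 1.5 at `r = 1`); no `p`-adic height, no control
theorem, no (C2_η-GZ), no (C3_η). Nothing is asserted about either input.
[cite: Kobayashi2003, Thm. 7.4 (p. 13)] [cite: BurnsKuriharaSano2019, Conj. 1.5 (p. 6), Thm. 7.6 and Remark 7.7 (p. 29)]
[cite: Kato2004Asterisque, Conj. 12.10 (p. 224), §14.14 (p. 243)] -/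
theorem missingPPartAt_rankOne_of_plusMC_of_perrinRiou_of_bridge
    (hC : RankOneCountReading IsOf PRRatio) (hreal : Realizable IsOf)
    (hread : ReadsTrivialKMC IsOf KMC) (hB : QuadraticBranchKatoBridge KMC)
    (hGZK : rank_eq_analyticRank_of_analyticRank_le_one) (hmod : hasEntireLFunction_rat)
    (W : WeierstrassCurve ℚ) [W.IsElliptic] [W.IsGloballyMinimal]
    (V : WeierstrassCurve ℚ) [V.IsElliptic] [V.IsGloballyMinimal] (C : VariableChange ℚ)
    (p : ℕ) [Fact p.Prime] (hr : W.analyticRank = 1) (hp : p ≠ 2) (hadd : Addv W p)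
    (hj : 0 ≤ padicValRat p W.j) (hK : Kato2004.ImageContainsSL2 W p)
    (hWV : C • W.quadraticTwist ((-1) ^ (p / 2) * p) = V) (hgood : V.HasGoodReductionAtPrime p)
    (hap : V.frobeniusTrace p = 0) (h1 : QuadraticBranchPlusMainConjectureAt V p)
    (hPR : PerrinRiouUpToUnitAt PRRatio W p) : MissingPPartAt W p :=
  rankOne_missingPPartAt_of_kmc_of_perrinRiou W p hC hreal hread hGZK hmod hr hp hadd hj hK hPR
    (kmc_of_plusMC_of_bridge hB W V C p hp hWV hgood hap hK h1)

/-- **RANK ONE — (C1_η)(V) + PR^×(W) ⇒ `BSD(W,p)`** (Miller's `BSDp`), same hypotheses.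
[cite: Kobayashi2003, Thm. 7.4 (p. 13)] [cite: BurnsKuriharaSano2019, Thm. 7.6 (p. 29)] [cite: Miller2011LMS, Def. 1.1] -/
theorem bsdp_rankOne_of_plusMC_of_perrinRiou_of_bridge
    (hC : RankOneCountReading IsOf PRRatio) (hreal : Realizable IsOf)
    (hread : ReadsTrivialKMC IsOf KMC) (hB : QuadraticBranchKatoBridge KMC)
    (hGZK : rank_eq_analyticRank_of_analyticRank_le_one) (hmod : hasEntireLFunction_rat)
    (W : WeierstrassCurve ℚ) [W.IsElliptic] [W.IsGloballyMinimal]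
    (V : WeierstrassCurve ℚ) [V.IsElliptic] [V.IsGloballyMinimal] (C : VariableChange ℚ)
    (p : ℕ) [Fact p.Prime] (hr : W.analyticRank = 1) (hp : p ≠ 2) (hadd : Addv W p)
    (hj : 0 ≤ padicValRat p W.j) (hK : Kato2004.ImageContainsSL2 W p)
    (hWV : C • W.quadraticTwist ((-1) ^ (p / 2) * p) = V) (hgood : V.HasGoodReductionAtPrime p)
    (hap : V.frobeniusTrace p = 0) (h1 : QuadraticBranchPlusMainConjectureAt V p)
    (hPR : PerrinRiouUpToUnitAt PRRatio W p) : BSDp W p :=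
  bsdp_of_missingPPartAt W p hGZK (by rw [hr])
    (missingPPartAt_rankOne_of_plusMC_of_perrinRiou_of_bridge hC hreal hread hB hGZK hmod W V C p hr
      hp hadd hj hK hWV hgood hap h1 hPR)

/-- **RANK ONE — (C1_η)(V) + (C2_η-GZ)(W, p) ⇒ `MissingPPartAt W p` GIVEN a witness of (C2_η-GZ)'s
binders**, over the bridge (T-e2-K), the dictionary D_η (T-e2-D, `EtaBranchDerivativeDictionary`),
`HasPRRatio`, kmc's split readings and Gross–Zagier I.(7.3) (rationality of `L′(W,1)/(Ω_W·Reg W)`,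
with GZK for `rank W(ℚ) = 1`): (C2_η-GZ) + D_η ⇒ PR^×(W)
(`perrinRiouUpToUnit_of_pAdicGrossZagierValuation_of_dictionary`), then the previous theorem. This
is the KATO chain driven by x1b's two typed nodes (C1_η), (C2_η-GZ); the SIGNED chain
(`bsdp_of_quadraticBranchPAdicGrossZagierValuation_of_exactControl`, p307042) uses (C1_η), (C2_η-GZ)
and (C3_η) — TARGET v4 §6 item 14's "ONE theorem modulo {C1_η ≡ KMC⁰(W), PR^× ≡ C2_η-GZ}" in
kernel form. The witness binders (`5 ≤ p`, twin data, newform, period ratio `ϖ`, minus function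
`L`, `W(ℚ_p)[p] = 0`, generator `P` of `p`-divisibility level `n`) are (C2_η-GZ)'s own, displayed.
[cite: Kobayashi2003, (3.7) (p. 7), Thm. 6.3 (p. 11), Thm. 7.4 (p. 13)] [cite: BurnsKuriharaSano2019, Conj. 1.5 (p. 6), Thm. 7.6 (p. 29)]
[cite: GrossZagier1986, Thm. I.(7.3)] [cite: Kato2004Asterisque, Conj. 12.10 (p. 224), Thm. 12.5 (4) and (12.5.2) (p. 222)] -/
theorem missingPPartAt_rankOne_of_plusMC_of_pAdicGrossZagier_of_bridge_of_dictionary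
    (hC : RankOneCountReading IsOf PRRatio) (hPR4 : HasPRRatio PRRatio) (hreal : Realizable IsOf)
    (hread : ReadsTrivialKMC IsOf KMC) (hB : QuadraticBranchKatoBridge KMC)
    (hD : EtaBranchDerivativeDictionary PRRatio) (hGZK : rank_eq_analyticRank_of_analyticRank_le_one)
    (hmod : hasEntireLFunction_rat) (hGZ : GrossZagier1986_thm_I_7_3)
    (W : WeierstrassCurve ℚ) [W.IsElliptic] [W.IsGloballyMinimal]
    (V : WeierstrassCurve ℚ) [V.IsElliptic] [V.IsGloballyMinimal] (C : VariableChange ℚ)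
    (p : ℕ) [Fact p.Prime] {N : ℕ} [NeZero N] {f : CuspForm (Gamma0 N) 2} (hp5 : 5 ≤ p)
    (hr : W.analyticRank = 1) (hadd : Addv W p) (hj : 0 ≤ padicValRat p W.j)
    (hK : Kato2004.ImageContainsSL2 W p) (hWV : C • W.quadraticTwist ((-1) ^ (p / 2) * p) = V)
    (hgood : V.HasGoodReductionAtPrime p) (hap : V.frobeniusTrace p = 0) (hf : IsNewformOf V f)
    (ϖ : ℚ) (hϖ : if Even (p / 2) then (ϖ : ℝ) * V.realPeriodRat = plusPeriod f
      else (ϖ : ℝ) * V.imaginaryPeriodRat = minusPeriod f)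
    (L : IwasawaAlgebra p) (hL : IsQuadraticBranchMinusLFunction f p ϖ L)
    (htors : ∀ Q : (W.baseChange ℚ_[p]).toAffine.Point, p • Q = 0 → Q = 0)
    (P : W.toAffine.Point) (n : ℕ) (hP : ¬ IsOfFinAddOrder P)
    (hgen : ∀ R : W.toAffine.Point, ∃ (k : ℤ) (T : W.toAffine.Point),
      IsOfFinAddOrder T ∧ R = k • P + T)
    (hdiv : ∃ Q : (W.baseChange ℚ_[p]).toAffine.Point, p ^ n • Q = W.toPadicPoint p P)
    (hndiv : ∀ Q : (W.baseChange ℚ_[p]).toAffine.Point, p ^ (n + 1) • Q ≠ W.toPadicPoint p P)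
    (h1 : QuadraticBranchPlusMainConjectureAt V p) (h2 : QuadraticBranchPAdicGrossZagierValuationAt W p) :
    MissingPPartAt W p := by
  have hp : p ≠ 2 := by omega
  have hrk : W.mordellWeilRank = 1 := (hGZK W (by rw [hr])).1.trans hr
  obtain ⟨c, -, hc⟩ := leadingLCoeff_eq_rat_mul_of_analyticRank_eq_one hGZ hr hrk
  have hΩ : (W.realPeriodRat : ℂ) ≠ 0 := by exact_mod_cast W.realPeriodRat_pos_holds.ne'
  have hR : (W.regulator : ℂ) ≠ 0 := by exact_mod_cast W.regulator_pos'.ne'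
  have hq : W.leadingLCoeff / ((W.realPeriodRat : ℂ) * (W.regulator : ℂ)) = (c : ℂ) := by
    rw [div_eq_iff (mul_ne_zero hΩ hR), hc]
    push_cast
    ring
  exact missingPPartAt_rankOne_of_plusMC_of_perrinRiou_of_bridge hC hreal hread hB hGZK hmod W V C p hr
    hp hadd hj hK hWV hgood hap h1
    (perrinRiouUpToUnit_of_pAdicGrossZagierValuation_of_dictionary hD hPR4 W p V C hp5 hWV hgood hap hr
      hf ϖ hϖ L hL htors P n hP hgen hdiv hndiv hadd hj hK c hq h2)

/-- **RANK ONE — (C1_η)(V) + (C2_η-GZ)(W, p) + witness ⇒ `BSD(W,p)`** (Miller's `BSDp`), same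
hypotheses. [cite: Kobayashi2003, Thm. 7.4 (p. 13)] [cite: BurnsKuriharaSano2019, Thm. 7.6 (p. 29)]
[cite: GrossZagier1986, Thm. I.(7.3)] [cite: Miller2011LMS, Def. 1.1] -/
theorem bsdp_rankOne_of_plusMC_of_pAdicGrossZagier_of_bridge_of_dictionary
    (hC : RankOneCountReading IsOf PRRatio) (hPR4 : HasPRRatio PRRatio) (hreal : Realizable IsOf)
    (hread : ReadsTrivialKMC IsOf KMC) (hB : QuadraticBranchKatoBridge KMC)
    (hD : EtaBranchDerivativeDictionary PRRatio) (hGZK : rank_eq_analyticRank_of_analyticRank_le_one)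
    (hmod : hasEntireLFunction_rat) (hGZ : GrossZagier1986_thm_I_7_3)
    (W : WeierstrassCurve ℚ) [W.IsElliptic] [W.IsGloballyMinimal]
    (V : WeierstrassCurve ℚ) [V.IsElliptic] [V.IsGloballyMinimal] (C : VariableChange ℚ)
    (p : ℕ) [Fact p.Prime] {N : ℕ} [NeZero N] {f : CuspForm (Gamma0 N) 2} (hp5 : 5 ≤ p)
    (hr : W.analyticRank = 1) (hadd : Addv W p) (hj : 0 ≤ padicValRat p W.j)
    (hK : Kato2004.ImageContainsSL2 W p) (hWV : C • W.quadraticTwist ((-1) ^ (p / 2) * p) = V)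
    (hgood : V.HasGoodReductionAtPrime p) (hap : V.frobeniusTrace p = 0) (hf : IsNewformOf V f)
    (ϖ : ℚ) (hϖ : if Even (p / 2) then (ϖ : ℝ) * V.realPeriodRat = plusPeriod f
      else (ϖ : ℝ) * V.imaginaryPeriodRat = minusPeriod f)
    (L : IwasawaAlgebra p) (hL : IsQuadraticBranchMinusLFunction f p ϖ L)
    (htors : ∀ Q : (W.baseChange ℚ_[p]).toAffine.Point, p • Q = 0 → Q = 0)
    (P : W.toAffine.Point) (n : ℕ) (hP : ¬ IsOfFinAddOrder P)
    (hgen : ∀ R : W.toAffine.Point, ∃ (k : ℤ) (T : W.toAffine.Point),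
      IsOfFinAddOrder T ∧ R = k • P + T)
    (hdiv : ∃ Q : (W.baseChange ℚ_[p]).toAffine.Point, p ^ n • Q = W.toPadicPoint p P)
    (hndiv : ∀ Q : (W.baseChange ℚ_[p]).toAffine.Point, p ^ (n + 1) • Q ≠ W.toPadicPoint p P)
    (h1 : QuadraticBranchPlusMainConjectureAt V p) (h2 : QuadraticBranchPAdicGrossZagierValuationAt W p) :
    BSDp W p :=
  bsdp_of_missingPPartAt W p hGZK (by rw [hr])
    (missingPPartAt_rankOne_of_plusMC_of_pAdicGrossZagier_of_bridge_of_dictionary hC hPR4 hreal hread hB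
      hD hGZK hmod hGZ W V C p hp5 hr hadd hj hK hWV hgood hap hf ϖ hϖ L hL htors P n hP hgen hdiv hndiv
      h1 h2)

end BridgeRankOneSplit

end Summit.BirchSwinnertonDyer.Rank1Residual.Additive

end
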